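/-
Copyright: the b2b-balaban T⁴-continuum CRUX team, row NE7b, leaf lineage `t4-ne7b-formalise-leaf-02` (gen 132). Project licence.
-/
import Literature.MathematicalPhysics.QuantumFieldTheory.Balaban1983to89.B7Prop1Explicit
import Literature.MathematicalPhysics.QuantumFieldTheory.Balaban1983to89.B8Ineq170
import Summits.QuantumFields.BalabanUV.T4Continuum.Support.GaugeFieldPerturbation
import Mathlib.Tactic.Group
import Mathlib.Tactic.NoncommRing

/-!
# THE THREE LOOP LETTERS OF LEMMA CS (ii) AT ONE STEP, I — the group algebra and the unit-ball bounds: each transport discrepancy of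
# `…OneStepCovariantStokes` is a product of conjugates of block loops `Wᵢ = gᵢ tᵢ gᵢ₊⁻¹ sᵢ⁻¹` ([B7] (42), `V(Γ_{c,x})V(c)⁻¹`) — ONE for the second side,
# THREE for the third, FOUR for the fourth — plus the substitution of the coarse bond variables `uᵢ` for the straight fine transporters `sᵢ` ((R-V));
# hence `δ₂ ≤ w₁ + ε₁`, `δ₃ ≤ Σ_{i≤3}(wᵢ + εᵢ)`, `δ₄ ≤ Σ_{i≤4}(wᵢ + εᵢ)` for `‖Wᵢ − 1‖ ≤ wᵢ`, `‖uᵢ − sᵢ‖ ≤ εᵢ` (row NE7b, node U5c; the (h1) slot of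
# print's `γ₀` assembly, `SectE-interface-proof.md` §5.2 Lemma CS (ii) «The two transports connect the same endpoints by fine paths … enclosing `O(d)`
# unit squares … and `V`(unit bond) differs from the `U`-transport along the straight fine path by `≤ c′ε_F` … hence `|Ad(·) − Ad(·)| ≤ 2|· − ·| ≤ c_g ε_F`»;
# part II `…OneStepLoopLettersValue` reads `Wᵢ` as [B7]'s `Wcx` and values everything under (44)∕(109))

Cell `pub-balaban`, sub-cell `t4`, spine estimate NE7b (`T4WeightBudget.RelWeightBound`; the cell's OWN estimate — NOT PRINTED in
[Bałaban 1983–89], NOT PROVED).  Crux-route work under `Spine/NE7b/` by the row's E-side ∕ key-readings ∕ lattice-geometry leaf lineage; NOTHING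
of Bałaban's is asserted; no `T4Continuum/Support` leaf typed; no `def`, no notation; zero `sorry`.  Imports (hub olean present):
`Literature.….B7Prop1Explicit` (lit-balaban b07: the unit-ball subgroup `U1` and its letters `mem_U1`, `norm_units_conj_sub_one_le`,
`norm_units_inv_conj_sub_one_le`, `norm_inv_sub_one_le`), `Literature.….B8Ineq170` (`norm_mul_sub_one_le_of_norm_le_one`),
`Summits.….T4Continuum.Support.GaugeFieldPerturbation` (`norm_units_inv_sub_inv_le`) — all REUSED BY NAME —, `Mathlib.Tactic.Group ∕ NoncommRing`.

WHY (located).  `…OneStepCovariantStokes.norm_coarseCurl_Q0cov_le` (this lineage, gen 132) proves Lemma CS (ii) at `k = 1` against [B7]'s (125) with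
three DISPLAYED closed-loop letters at every block point `x = q + r` of the coarse plaquette `P = (q; κ, μ)`:
`δ₂ ≥ ‖(g t₁)⁻¹(u₁g′) − 1‖`, `δ₃ ≥ ‖(g t₁t₂t₃⁻¹)⁻¹(u₁u₂u₃⁻¹g″) − 1‖`, `δ₄ ≥ ‖(g t₁t₂t₃⁻¹t₄⁻¹)⁻¹(u₁u₂u₃⁻¹u₄⁻¹g) − 1‖` (`g, g′, g″` the tree contours of
the blocks of `q`, `q + Le_κ`, `q + Le_μ`; `t₁ … t₄` the fine transporters along the sides of `S_x(P)`; `u₁ … u₄` the coarse bond variables).  With the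
straight fine transporters `sᵢ` in place of the `uᵢ`, each loop is — EXACTLY, in any group — a product of conjugates of `W₁ = g t₁ g′⁻¹ s₁⁻¹`,
`W₂ = g′ t₂ g‴⁻¹ s₂⁻¹`, `W₃ = g″ t₃ g‴⁻¹ s₃⁻¹`, `W₄ = g t₄ g″⁻¹ s₄⁻¹` (a fourth tree contour `g‴` — block of `q + Le_κ + Le_μ` — cancels); in the unit
ball conjugation and inversion do not increase `‖· − 1‖`, products add it, and `uᵢ ↦ sᵢ` costs `‖uᵢ − sᵢ‖` each.  THIS FILE is that algebra; part II
identifies `Wᵢ` with [B7]'s `Wcx` and puts in the tree's values.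

WHAT IS PROVED ([folklore] group algebra + unit-ball triangle inequalities; `𝔸` a normed ring with `‖1‖ = 1`):
* §1 unit-ball bookkeeping: `norm_sandwich_sub_le` (`‖x‖, ‖y‖ ≤ 1` ⊢ `‖xuy − xsy‖ ≤ ‖u − s‖`), `norm_mul_sub_mul_le` (`‖ab − a′b′‖ ≤ ‖a − a′‖ + ‖b − b′‖`
  for `‖a‖, ‖b′‖ ≤ 1`); `‖ab − 1‖ ≤ ‖a − 1‖ + ‖b − 1‖` and `‖u⁻¹ − s⁻¹‖ ≤ ‖u − s‖` are the tree's
  `B8Ineq170.norm_mul_sub_one_le_of_norm_le_one` ∕ `GaugeFieldPerturbation.norm_units_inv_sub_inv_le`, BY NAME.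
* §2 THE SECOND SIDE: `loop2_eq_conj` (`(g t₁)⁻¹(s₁g′) = (g t₁)⁻¹·W₁⁻¹·(g t₁)` — `group`), **`delta2_le`** (`‖(g t₁)⁻¹(u₁g′) − 1‖ ≤ w₁ + ε₁`).
* §3 THE THIRD SIDE: `loop3_eq_prod` (`g″·loop₃ˢ·g″⁻¹ = W₃ · (c₂W₂⁻¹c₂⁻¹) · (c₁W₁⁻¹c₁⁻¹)`, `c₂ = s₃s₂⁻¹`, `c₁ = s₃s₂⁻¹s₁⁻¹` — `group`), **`delta3_le`**
  (`‖(g t₁t₂t₃⁻¹)⁻¹(u₁u₂u₃⁻¹g″) − 1‖ ≤ (w₁ + w₂ + w₃) + (ε₁ + ε₂ + ε₃)`).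
* §4 THE FOURTH SIDE: `loop4_eq_prod` (`g·loop₄ˢ·g⁻¹ = W₄ · ((s₄W₃′s₄⁻¹)(c₂′W₂⁻¹c₂′⁻¹)(c₁′W₁⁻¹c₁′⁻¹))` — `group`), **`delta4_le`**
  (`≤ (w₁ + w₂ + w₃ + w₄) + (ε₁ + ε₂ + ε₃ + ε₄)`).

NOT HERE (honest): the identification of `Wᵢ` with `B7Prop1Explicit.Wcx` and the values `wᵢ = 16(d+1)(d+4)L²α₀` (`B7Prop2Explicit.norm_Wcx_sub_one_le`),
`εᵢ = 64(d+1)(d+4)L²α₀` (`B7Eq47AveragedBondVsStraight`) — part II; `k > 1`; everything else of Lemma CS; (A3) ∕ (A1c), NC-NE7b-α UNRULED.  BY-NAME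
EFFECT ON THE WALL: NONE.  NE7b NOT PRINTED ∕ NOT PROVED; spine PROVED 0∕9; rung (B)+1 on a FINITE torus — NOT infinite volume, NOT the mass gap,
NOT Clay.
HONEST DEPENDENCY: continuum YM on T⁴ ⇐ BetaPertH ∧ nine spine estimates (0/9 proved); BetaPertH ⇐ (D1) ∧ (D4) ∧ CAP+tail; G-an2-4 gates
asym, D1 and NE2/3/4.
-/

set_option autoImplicit false

noncomputable section

open Literature.MathematicalPhysics.QuantumFieldTheory.Balaban1983to89
open Literature.MathematicalPhysics.QuantumFieldTheory.Balaban1983to89.B7Prop1Explicit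
  (U1 mem_U1 norm_units_conj_sub_one_le norm_units_inv_conj_sub_one_le norm_inv_sub_one_le)

namespace Summit.QuantumFields.BalabanUV.T4Continuum.NE7b.OneStepLoopLetters

variable {𝔸 : Type*} [NormedRing 𝔸] [NormOneClass 𝔸]

/-! ## §1 Unit-ball bookkeeping -/

section UnitBall

omit [NormOneClass 𝔸] in
/-- `‖x‖, ‖y‖ ≤ 1` ⊢ `‖xuy − xsy‖ ≤ ‖u − s‖`. [folklore] -/
theorem norm_sandwich_sub_le {x y u s : 𝔸} (hx : ‖x‖ ≤ 1) (hy : ‖y‖ ≤ 1) : ‖x * u * y - x * s * y‖ ≤ ‖u - s‖ := by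
  have e1 : x * u * y - x * s * y = x * (u - s) * y := by noncomm_ring
  rw [e1]
  calc ‖x * (u - s) * y‖ ≤ ‖x‖ * ‖u - s‖ * ‖y‖ := (norm_mul_le _ _).trans (mul_le_mul_of_nonneg_right (norm_mul_le _ _) (norm_nonneg _))
    _ ≤ 1 * ‖u - s‖ * 1 := by gcongr
    _ = ‖u - s‖ := by ring

omit [NormOneClass 𝔸] in
/-- In the unit ball products are 1-Lipschitz in each factor: `‖ab − a′b′‖ ≤ ‖a − a′‖ + ‖b − b′‖` for `‖a‖, ‖b′‖ ≤ 1`. [folklore] -/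
theorem norm_mul_sub_mul_le {a b a' b' : 𝔸} (ha : ‖a‖ ≤ 1) (hb' : ‖b'‖ ≤ 1) : ‖a * b - a' * b'‖ ≤ ‖a - a'‖ + ‖b - b'‖ := by
  have e1 : a * b - a' * b' = a * (b - b') + (a - a') * b' := by noncomm_ring
  rw [e1]
  refine (norm_add_le _ _).trans ?_
  have h1 := norm_mul_le a (b - b')
  have h2 := norm_mul_le (a - a') b'
  nlinarith [norm_nonneg (b - b'), norm_nonneg (a - a')]

end UnitBall

/-! ## §2 The second side: ONE block loop -/

section Second

/-- **THE SECOND LOOP IS A CONJUGATE OF `W₁⁻¹`**: with `W₁ = g t₁ g′⁻¹ s₁⁻¹`, `(g t₁)⁻¹(s₁ g′) = (g t₁)⁻¹·W₁⁻¹·(g t₁)`. [folklore] -/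
theorem loop2_eq_conj {G : Type*} [Group G] (g t₁ g' s₁ : G) :
    (g * t₁)⁻¹ * (s₁ * g') = (g * t₁)⁻¹ * (g * t₁ * g'⁻¹ * s₁⁻¹)⁻¹ * (g * t₁) := by
  group

/-- **`δ₂ ≤ w₁ + ε₁`**: if `‖W₁ − 1‖ ≤ w₁` for `W₁ = g t₁ g′⁻¹ s₁⁻¹` and `‖u₁ − s₁‖ ≤ ε₁`, all letters in `U1`, then
`‖(g t₁)⁻¹(u₁ g′) − 1‖ ≤ w₁ + ε₁`. [folklore] -/
theorem delta2_le {g t₁ g' s₁ u₁ : 𝔸ˣ} (hg : g ∈ U1 𝔸) (ht₁ : t₁ ∈ U1 𝔸) (hg' : g' ∈ U1 𝔸) (hs₁ : s₁ ∈ U1 𝔸)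
    {w₁ ε₁ : ℝ} (hW : ‖((g * t₁ * g'⁻¹ * s₁⁻¹ : 𝔸ˣ) : 𝔸) - 1‖ ≤ w₁) (hu : ‖(u₁ : 𝔸) - (s₁ : 𝔸)‖ ≤ ε₁) :
    ‖(((g * t₁)⁻¹ * (u₁ * g') : 𝔸ˣ) : 𝔸) - 1‖ ≤ w₁ + ε₁ := by
  have hgt : g * t₁ ∈ U1 𝔸 := (U1 𝔸).mul_mem hg ht₁
  -- the `s₁` version is a conjugate of `W₁⁻¹`
  have h1 : ‖(((g * t₁)⁻¹ * (s₁ * g') : 𝔸ˣ) : 𝔸) - 1‖ ≤ w₁ := by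
    rw [loop2_eq_conj g t₁ g' s₁, Units.val_mul, Units.val_mul]
    refine (norm_units_inv_conj_sub_one_le hgt _).trans ?_
    exact (norm_inv_sub_one_le ((U1 𝔸).mul_mem ((U1 𝔸).mul_mem ((U1 𝔸).mul_mem hg ht₁) ((U1 𝔸).inv_mem hg'))
      ((U1 𝔸).inv_mem hs₁))).trans hW
  -- the substitution `u₁ ↦ s₁`
  have h2 : ‖(((g * t₁)⁻¹ * (u₁ * g') : 𝔸ˣ) : 𝔸) - (((g * t₁)⁻¹ * (s₁ * g') : 𝔸ˣ) : 𝔸)‖ ≤ ε₁ := by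
    simp only [Units.val_mul, ← mul_assoc]
    exact (norm_sandwich_sub_le (mem_U1.1 ((U1 𝔸).inv_mem hgt)).1 (mem_U1.1 hg').1).trans hu
  have e : (((g * t₁)⁻¹ * (u₁ * g') : 𝔸ˣ) : 𝔸) - 1
      = ((((g * t₁)⁻¹ * (u₁ * g') : 𝔸ˣ) : 𝔸) - (((g * t₁)⁻¹ * (s₁ * g') : 𝔸ˣ) : 𝔸))
        + ((((g * t₁)⁻¹ * (s₁ * g') : 𝔸ˣ) : 𝔸) - 1) := by abel
  rw [e]
  exact (norm_add_le _ _).trans (by linarith)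

end Second

/-! ## §3 The third side: THREE block loops -/

section Third

/-- **THE THIRD LOOP AS A PRODUCT OF CONJUGATES**: with `W₁ = g t₁ g′⁻¹ s₁⁻¹`, `W₂ = g′ t₂ g‴⁻¹ s₂⁻¹`, `W₃ = g″ t₃ g‴⁻¹ s₃⁻¹`,
`g″·(t₃t₂⁻¹t₁⁻¹g⁻¹ s₁s₂s₃⁻¹ g″)·g″⁻¹ = W₃ · ((s₃s₂⁻¹)·W₂⁻¹·(s₃s₂⁻¹)⁻¹) · (s₁⁻¹·W₁⁻¹·s₁)` — no, with the last conjugate also by `s₃s₂⁻¹`: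
precisely the identity checked by `group` below. [folklore] -/
theorem loop3_eq_prod {G : Type*} [Group G] (g t₁ g' s₁ t₂ g''' s₂ g'' t₃ s₃ : G) :
    g'' * ((g * (t₁ * t₂ * t₃⁻¹))⁻¹ * (s₁ * s₂ * s₃⁻¹ * g'')) * g''⁻¹
      = (g'' * t₃ * g'''⁻¹ * s₃⁻¹)
        * ((s₃ * s₂⁻¹) * (g' * t₂ * g'''⁻¹ * s₂⁻¹)⁻¹ * (s₃ * s₂⁻¹)⁻¹)
        * ((s₃ * s₂⁻¹ * s₁⁻¹) * (g * t₁ * g'⁻¹ * s₁⁻¹)⁻¹ * (s₃ * s₂⁻¹ * s₁⁻¹)⁻¹) := by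
  group

/-- **`δ₃ ≤ (w₁ + w₂ + w₃) + (ε₁ + ε₂ + ε₃)`**: three block loops (conjugated, one inverted) and three substitutions. [folklore] -/
theorem delta3_le {g t₁ g' s₁ t₂ g''' s₂ g'' t₃ s₃ u₁ u₂ u₃ : 𝔸ˣ}
    (hg : g ∈ U1 𝔸) (ht₁ : t₁ ∈ U1 𝔸) (hg' : g' ∈ U1 𝔸) (hs₁ : s₁ ∈ U1 𝔸) (ht₂ : t₂ ∈ U1 𝔸) (hg''' : g''' ∈ U1 𝔸)
    (hs₂ : s₂ ∈ U1 𝔸) (hg'' : g'' ∈ U1 𝔸) (ht₃ : t₃ ∈ U1 𝔸) (hs₃ : s₃ ∈ U1 𝔸)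
    (hu₁ : u₁ ∈ U1 𝔸) (hu₂ : u₂ ∈ U1 𝔸) (hu₃ : u₃ ∈ U1 𝔸)
    {w₁ w₂ w₃ ε₁ ε₂ ε₃ : ℝ}
    (hW₁ : ‖((g * t₁ * g'⁻¹ * s₁⁻¹ : 𝔸ˣ) : 𝔸) - 1‖ ≤ w₁) (hW₂ : ‖((g' * t₂ * g'''⁻¹ * s₂⁻¹ : 𝔸ˣ) : 𝔸) - 1‖ ≤ w₂)
    (hW₃ : ‖((g'' * t₃ * g'''⁻¹ * s₃⁻¹ : 𝔸ˣ) : 𝔸) - 1‖ ≤ w₃)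
    (hu₁s : ‖(u₁ : 𝔸) - (s₁ : 𝔸)‖ ≤ ε₁) (hu₂s : ‖(u₂ : 𝔸) - (s₂ : 𝔸)‖ ≤ ε₂) (hu₃s : ‖(u₃ : 𝔸) - (s₃ : 𝔸)‖ ≤ ε₃) :
    ‖((((g * (t₁ * t₂ * t₃⁻¹))⁻¹ * (u₁ * u₂ * u₃⁻¹ * g'')) : 𝔸ˣ) : 𝔸) - 1‖ ≤ (w₁ + w₂ + w₃) + (ε₁ + ε₂ + ε₃) := by
  -- memberships
  have hW₁m : g * t₁ * g'⁻¹ * s₁⁻¹ ∈ U1 𝔸 :=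
    (U1 𝔸).mul_mem ((U1 𝔸).mul_mem ((U1 𝔸).mul_mem hg ht₁) ((U1 𝔸).inv_mem hg')) ((U1 𝔸).inv_mem hs₁)
  have hW₂m : g' * t₂ * g'''⁻¹ * s₂⁻¹ ∈ U1 𝔸 :=
    (U1 𝔸).mul_mem ((U1 𝔸).mul_mem ((U1 𝔸).mul_mem hg' ht₂) ((U1 𝔸).inv_mem hg''')) ((U1 𝔸).inv_mem hs₂)
  have hW₃m : g'' * t₃ * g'''⁻¹ * s₃⁻¹ ∈ U1 𝔸 :=
    (U1 𝔸).mul_mem ((U1 𝔸).mul_mem ((U1 𝔸).mul_mem hg'' ht₃) ((U1 𝔸).inv_mem hg''')) ((U1 𝔸).inv_mem hs₃)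
  have hc₂ : s₃ * s₂⁻¹ ∈ U1 𝔸 := (U1 𝔸).mul_mem hs₃ ((U1 𝔸).inv_mem hs₂)
  have hc₁ : s₃ * s₂⁻¹ * s₁⁻¹ ∈ U1 𝔸 := (U1 𝔸).mul_mem hc₂ ((U1 𝔸).inv_mem hs₁)
  have hpre : g * (t₁ * t₂ * t₃⁻¹) ∈ U1 𝔸 :=
    (U1 𝔸).mul_mem hg ((U1 𝔸).mul_mem ((U1 𝔸).mul_mem ht₁ ht₂) ((U1 𝔸).inv_mem ht₃))
  -- the `s` version: conjugate by `g''`, then a product of three conjugated loops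
  have hs_version : ‖((((g * (t₁ * t₂ * t₃⁻¹))⁻¹ * (s₁ * s₂ * s₃⁻¹ * g'')) : 𝔸ˣ) : 𝔸) - 1‖ ≤ w₁ + w₂ + w₃ := by
    have hconj := norm_units_inv_conj_sub_one_le hg''
      (((g'' * ((g * (t₁ * t₂ * t₃⁻¹))⁻¹ * (s₁ * s₂ * s₃⁻¹ * g'')) * g''⁻¹ : 𝔸ˣ)) : 𝔸)
    have e0 : ((g''⁻¹ : 𝔸ˣ) : 𝔸) * (((g'' * ((g * (t₁ * t₂ * t₃⁻¹))⁻¹ * (s₁ * s₂ * s₃⁻¹ * g'')) * g''⁻¹ : 𝔸ˣ)) : 𝔸) * (g'' : 𝔸)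
        = ((((g * (t₁ * t₂ * t₃⁻¹))⁻¹ * (s₁ * s₂ * s₃⁻¹ * g'')) : 𝔸ˣ) : 𝔸) := by
      rw [← Units.val_mul, ← Units.val_mul]
      congr 1
      group
    rw [e0] at hconj
    refine hconj.trans ?_
    rw [loop3_eq_prod g t₁ g' s₁ t₂ g''' s₂ g'' t₃ s₃, Units.val_mul, Units.val_mul]
    have hA := hW₃
    have hB : ‖(((s₃ * s₂⁻¹) * (g' * t₂ * g'''⁻¹ * s₂⁻¹)⁻¹ * (s₃ * s₂⁻¹)⁻¹ : 𝔸ˣ) : 𝔸) - 1‖ ≤ w₂ := by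
      rw [Units.val_mul, Units.val_mul]
      exact (norm_units_conj_sub_one_le hc₂ _).trans ((norm_inv_sub_one_le hW₂m).trans hW₂)
    have hC : ‖(((s₃ * s₂⁻¹ * s₁⁻¹) * (g * t₁ * g'⁻¹ * s₁⁻¹)⁻¹ * (s₃ * s₂⁻¹ * s₁⁻¹)⁻¹ : 𝔸ˣ) : 𝔸) - 1‖ ≤ w₁ := by
      rw [Units.val_mul, Units.val_mul]
      exact (norm_units_conj_sub_one_le hc₁ _).trans ((norm_inv_sub_one_le hW₁m).trans hW₁)
    have n1 : ‖((g'' * t₃ * g'''⁻¹ * s₃⁻¹ : 𝔸ˣ) : 𝔸)‖ ≤ 1 := (mem_U1.1 hW₃m).1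
    have n12 : ‖((g'' * t₃ * g'''⁻¹ * s₃⁻¹ : 𝔸ˣ) : 𝔸)
        * (((s₃ * s₂⁻¹) * (g' * t₂ * g'''⁻¹ * s₂⁻¹)⁻¹ * (s₃ * s₂⁻¹)⁻¹ : 𝔸ˣ) : 𝔸)‖ ≤ 1 := by
      rw [← Units.val_mul]
      exact (mem_U1.1 ((U1 𝔸).mul_mem hW₃m ((U1 𝔸).mul_mem ((U1 𝔸).mul_mem hc₂ ((U1 𝔸).inv_mem hW₂m))
        ((U1 𝔸).inv_mem hc₂)))).1
    have step1 := B8Ineq170.norm_mul_sub_one_le_of_norm_le_one (b := (((s₃ * s₂⁻¹ * s₁⁻¹) * (g * t₁ * g'⁻¹ * s₁⁻¹)⁻¹ * (s₃ * s₂⁻¹ * s₁⁻¹)⁻¹ : 𝔸ˣ) : 𝔸)) n12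
    have step2 := B8Ineq170.norm_mul_sub_one_le_of_norm_le_one (b := (((s₃ * s₂⁻¹) * (g' * t₂ * g'''⁻¹ * s₂⁻¹)⁻¹ * (s₃ * s₂⁻¹)⁻¹ : 𝔸ˣ) : 𝔸)) n1
    linarith
  -- the substitution `uᵢ ↦ sᵢ`
  have hsub : ‖((((g * (t₁ * t₂ * t₃⁻¹))⁻¹ * (u₁ * u₂ * u₃⁻¹ * g'')) : 𝔸ˣ) : 𝔸)
      - ((((g * (t₁ * t₂ * t₃⁻¹))⁻¹ * (s₁ * s₂ * s₃⁻¹ * g'')) : 𝔸ˣ) : 𝔸)‖ ≤ ε₁ + ε₂ + ε₃ := by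
    have e1 : ((((g * (t₁ * t₂ * t₃⁻¹))⁻¹ * (u₁ * u₂ * u₃⁻¹ * g'')) : 𝔸ˣ) : 𝔸)
        = (((g * (t₁ * t₂ * t₃⁻¹))⁻¹ : 𝔸ˣ) : 𝔸) * ((u₁ * u₂ * u₃⁻¹ : 𝔸ˣ) : 𝔸) * (g'' : 𝔸) := by
      simp only [Units.val_mul, mul_assoc]
    have e2 : ((((g * (t₁ * t₂ * t₃⁻¹))⁻¹ * (s₁ * s₂ * s₃⁻¹ * g'')) : 𝔸ˣ) : 𝔸)
        = (((g * (t₁ * t₂ * t₃⁻¹))⁻¹ : 𝔸ˣ) : 𝔸) * ((s₁ * s₂ * s₃⁻¹ : 𝔸ˣ) : 𝔸) * (g'' : 𝔸) := by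
      simp only [Units.val_mul, mul_assoc]
    rw [e1, e2]
    refine (norm_sandwich_sub_le (mem_U1.1 ((U1 𝔸).inv_mem hpre)).1 (mem_U1.1 hg'').1).trans ?_
    rw [Units.val_mul, Units.val_mul, Units.val_mul, Units.val_mul]
    have hus₁₂ := norm_mul_sub_mul_le (a := (u₁ : 𝔸)) (b := (u₂ : 𝔸)) (a' := (s₁ : 𝔸)) (b' := (s₂ : 𝔸))
      (mem_U1.1 hu₁).1 (mem_U1.1 hs₂).1
    have hus₃ := GaugeFieldPerturbation.norm_units_inv_sub_inv_le hu₃ hs₃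
    have hfin := norm_mul_sub_mul_le (a := (u₁ : 𝔸) * (u₂ : 𝔸)) (b := ((u₃⁻¹ : 𝔸ˣ) : 𝔸))
      (a' := (s₁ : 𝔸) * (s₂ : 𝔸)) (b' := ((s₃⁻¹ : 𝔸ˣ) : 𝔸))
      (by rw [← Units.val_mul]; exact (mem_U1.1 ((U1 𝔸).mul_mem hu₁ hu₂)).1) (mem_U1.1 ((U1 𝔸).inv_mem hs₃)).1
    linarith
  have e : ((((g * (t₁ * t₂ * t₃⁻¹))⁻¹ * (u₁ * u₂ * u₃⁻¹ * g'')) : 𝔸ˣ) : 𝔸) - 1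
      = (((((g * (t₁ * t₂ * t₃⁻¹))⁻¹ * (u₁ * u₂ * u₃⁻¹ * g'')) : 𝔸ˣ) : 𝔸)
          - ((((g * (t₁ * t₂ * t₃⁻¹))⁻¹ * (s₁ * s₂ * s₃⁻¹ * g'')) : 𝔸ˣ) : 𝔸))
        + (((((g * (t₁ * t₂ * t₃⁻¹))⁻¹ * (s₁ * s₂ * s₃⁻¹ * g'')) : 𝔸ˣ) : 𝔸) - 1) := by abel
  rw [e]
  exact (norm_add_le _ _).trans (by linarith)

end Third

/-! ## §4 The fourth side: FOUR block loops -/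

section Fourth

/-- **THE FOURTH LOOP AS A PRODUCT OF CONJUGATES**: with `W₄ = g t₄ g″⁻¹ s₄⁻¹` in addition, `g·loop₄ˢ·g⁻¹ = W₄ · (s₄ · [g″ loop₃ˢ g″⁻¹] · s₄⁻¹)`
and §4's product for the bracket — the identity checked by `group`. [folklore] -/
theorem loop4_eq_prod {G : Type*} [Group G] (g t₁ g' s₁ t₂ g''' s₂ g'' t₃ s₃ t₄ s₄ : G) :
    g * ((g * (t₁ * t₂ * t₃⁻¹ * t₄⁻¹))⁻¹ * (s₁ * s₂ * s₃⁻¹ * s₄⁻¹ * g)) * g⁻¹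
      = (g * t₄ * g''⁻¹ * s₄⁻¹)
        * ((s₄ * g'' * t₃ * g'''⁻¹ * s₃⁻¹ * s₄⁻¹)
          * ((s₄ * s₃ * s₂⁻¹) * (g' * t₂ * g'''⁻¹ * s₂⁻¹)⁻¹ * (s₄ * s₃ * s₂⁻¹)⁻¹)
          * ((s₄ * s₃ * s₂⁻¹ * s₁⁻¹) * (g * t₁ * g'⁻¹ * s₁⁻¹)⁻¹ * (s₄ * s₃ * s₂⁻¹ * s₁⁻¹)⁻¹)) := by
  group

/-- **`δ₄ ≤ (w₁ + w₂ + w₃ + w₄) + (ε₁ + ε₂ + ε₃ + ε₄)`**: four block loops and four substitutions. [folklore] -/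
theorem delta4_le {g t₁ g' s₁ t₂ g''' s₂ g'' t₃ s₃ t₄ s₄ u₁ u₂ u₃ u₄ : 𝔸ˣ}
    (hg : g ∈ U1 𝔸) (ht₁ : t₁ ∈ U1 𝔸) (hg' : g' ∈ U1 𝔸) (hs₁ : s₁ ∈ U1 𝔸) (ht₂ : t₂ ∈ U1 𝔸) (hg''' : g''' ∈ U1 𝔸)
    (hs₂ : s₂ ∈ U1 𝔸) (hg'' : g'' ∈ U1 𝔸) (ht₃ : t₃ ∈ U1 𝔸) (hs₃ : s₃ ∈ U1 𝔸) (ht₄ : t₄ ∈ U1 𝔸) (hs₄ : s₄ ∈ U1 𝔸)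
    (hu₁ : u₁ ∈ U1 𝔸) (hu₂ : u₂ ∈ U1 𝔸) (hu₃ : u₃ ∈ U1 𝔸) (hu₄ : u₄ ∈ U1 𝔸)
    {w₁ w₂ w₃ w₄ ε₁ ε₂ ε₃ ε₄ : ℝ}
    (hW₁ : ‖((g * t₁ * g'⁻¹ * s₁⁻¹ : 𝔸ˣ) : 𝔸) - 1‖ ≤ w₁) (hW₂ : ‖((g' * t₂ * g'''⁻¹ * s₂⁻¹ : 𝔸ˣ) : 𝔸) - 1‖ ≤ w₂)
    (hW₃ : ‖((g'' * t₃ * g'''⁻¹ * s₃⁻¹ : 𝔸ˣ) : 𝔸) - 1‖ ≤ w₃) (hW₄ : ‖((g * t₄ * g''⁻¹ * s₄⁻¹ : 𝔸ˣ) : 𝔸) - 1‖ ≤ w₄)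
    (hu₁s : ‖(u₁ : 𝔸) - (s₁ : 𝔸)‖ ≤ ε₁) (hu₂s : ‖(u₂ : 𝔸) - (s₂ : 𝔸)‖ ≤ ε₂) (hu₃s : ‖(u₃ : 𝔸) - (s₃ : 𝔸)‖ ≤ ε₃)
    (hu₄s : ‖(u₄ : 𝔸) - (s₄ : 𝔸)‖ ≤ ε₄) :
    ‖((((g * (t₁ * t₂ * t₃⁻¹ * t₄⁻¹))⁻¹ * (u₁ * u₂ * u₃⁻¹ * u₄⁻¹ * g)) : 𝔸ˣ) : 𝔸) - 1‖
      ≤ (w₁ + w₂ + w₃ + w₄) + (ε₁ + ε₂ + ε₃ + ε₄) := by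
  -- memberships
  have hW₁m : g * t₁ * g'⁻¹ * s₁⁻¹ ∈ U1 𝔸 :=
    (U1 𝔸).mul_mem ((U1 𝔸).mul_mem ((U1 𝔸).mul_mem hg ht₁) ((U1 𝔸).inv_mem hg')) ((U1 𝔸).inv_mem hs₁)
  have hW₂m : g' * t₂ * g'''⁻¹ * s₂⁻¹ ∈ U1 𝔸 :=
    (U1 𝔸).mul_mem ((U1 𝔸).mul_mem ((U1 𝔸).mul_mem hg' ht₂) ((U1 𝔸).inv_mem hg''')) ((U1 𝔸).inv_mem hs₂)
  have hW₃m : g'' * t₃ * g'''⁻¹ * s₃⁻¹ ∈ U1 𝔸 :=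
    (U1 𝔸).mul_mem ((U1 𝔸).mul_mem ((U1 𝔸).mul_mem hg'' ht₃) ((U1 𝔸).inv_mem hg''')) ((U1 𝔸).inv_mem hs₃)
  have hW₄m : g * t₄ * g''⁻¹ * s₄⁻¹ ∈ U1 𝔸 :=
    (U1 𝔸).mul_mem ((U1 𝔸).mul_mem ((U1 𝔸).mul_mem hg ht₄) ((U1 𝔸).inv_mem hg'')) ((U1 𝔸).inv_mem hs₄)
  have hc₃ : s₄ * g'' * t₃ * g'''⁻¹ * s₃⁻¹ * s₄⁻¹ ∈ U1 𝔸 :=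
    (U1 𝔸).mul_mem ((U1 𝔸).mul_mem ((U1 𝔸).mul_mem ((U1 𝔸).mul_mem ((U1 𝔸).mul_mem hs₄ hg'') ht₃)
      ((U1 𝔸).inv_mem hg''')) ((U1 𝔸).inv_mem hs₃)) ((U1 𝔸).inv_mem hs₄)
  have hc₂ : s₄ * s₃ * s₂⁻¹ ∈ U1 𝔸 := (U1 𝔸).mul_mem ((U1 𝔸).mul_mem hs₄ hs₃) ((U1 𝔸).inv_mem hs₂)
  have hc₁ : s₄ * s₃ * s₂⁻¹ * s₁⁻¹ ∈ U1 𝔸 := (U1 𝔸).mul_mem hc₂ ((U1 𝔸).inv_mem hs₁)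
  have hpre : g * (t₁ * t₂ * t₃⁻¹ * t₄⁻¹) ∈ U1 𝔸 :=
    (U1 𝔸).mul_mem hg ((U1 𝔸).mul_mem ((U1 𝔸).mul_mem ((U1 𝔸).mul_mem ht₁ ht₂) ((U1 𝔸).inv_mem ht₃)) ((U1 𝔸).inv_mem ht₄))
  -- the `s` version
  have hs_version : ‖((((g * (t₁ * t₂ * t₃⁻¹ * t₄⁻¹))⁻¹ * (s₁ * s₂ * s₃⁻¹ * s₄⁻¹ * g)) : 𝔸ˣ) : 𝔸) - 1‖
      ≤ w₁ + w₂ + w₃ + w₄ := by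
    have hconj := norm_units_inv_conj_sub_one_le hg
      (((g * ((g * (t₁ * t₂ * t₃⁻¹ * t₄⁻¹))⁻¹ * (s₁ * s₂ * s₃⁻¹ * s₄⁻¹ * g)) * g⁻¹ : 𝔸ˣ)) : 𝔸)
    have e0 : ((g⁻¹ : 𝔸ˣ) : 𝔸) * (((g * ((g * (t₁ * t₂ * t₃⁻¹ * t₄⁻¹))⁻¹ * (s₁ * s₂ * s₃⁻¹ * s₄⁻¹ * g)) * g⁻¹ : 𝔸ˣ)) : 𝔸)
          * (g : 𝔸)
        = ((((g * (t₁ * t₂ * t₃⁻¹ * t₄⁻¹))⁻¹ * (s₁ * s₂ * s₃⁻¹ * s₄⁻¹ * g)) : 𝔸ˣ) : 𝔸) := by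
      rw [← Units.val_mul, ← Units.val_mul]
      congr 1
      group
    rw [e0] at hconj
    refine hconj.trans ?_
    rw [loop4_eq_prod g t₁ g' s₁ t₂ g''' s₂ g'' t₃ s₃ t₄ s₄]
    -- the three inner pieces
    have hA : ‖((s₄ * g'' * t₃ * g'''⁻¹ * s₃⁻¹ * s₄⁻¹ : 𝔸ˣ) : 𝔸) - 1‖ ≤ w₃ := by
      have e3 : s₄ * g'' * t₃ * g'''⁻¹ * s₃⁻¹ * s₄⁻¹ = s₄ * (g'' * t₃ * g'''⁻¹ * s₃⁻¹) * s₄⁻¹ := by group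
      rw [e3, Units.val_mul, Units.val_mul]
      exact (norm_units_conj_sub_one_le hs₄ _).trans hW₃
    have hB : ‖(((s₄ * s₃ * s₂⁻¹) * (g' * t₂ * g'''⁻¹ * s₂⁻¹)⁻¹ * (s₄ * s₃ * s₂⁻¹)⁻¹ : 𝔸ˣ) : 𝔸) - 1‖ ≤ w₂ := by
      rw [Units.val_mul, Units.val_mul]
      exact (norm_units_conj_sub_one_le hc₂ _).trans ((norm_inv_sub_one_le hW₂m).trans hW₂)
    have hC : ‖(((s₄ * s₃ * s₂⁻¹ * s₁⁻¹) * (g * t₁ * g'⁻¹ * s₁⁻¹)⁻¹ * (s₄ * s₃ * s₂⁻¹ * s₁⁻¹)⁻¹ : 𝔸ˣ) : 𝔸) - 1‖ ≤ w₁ := by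
      rw [Units.val_mul, Units.val_mul]
      exact (norm_units_conj_sub_one_le hc₁ _).trans ((norm_inv_sub_one_le hW₁m).trans hW₁)
    have hBm : (s₄ * s₃ * s₂⁻¹) * (g' * t₂ * g'''⁻¹ * s₂⁻¹)⁻¹ * (s₄ * s₃ * s₂⁻¹)⁻¹ ∈ U1 𝔸 :=
      (U1 𝔸).mul_mem ((U1 𝔸).mul_mem hc₂ ((U1 𝔸).inv_mem hW₂m)) ((U1 𝔸).inv_mem hc₂)
    -- name the four factors and split the coercion once at each level
    set W₄ : 𝔸ˣ := g * t₄ * g''⁻¹ * s₄⁻¹ with hW₄def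
    set A₃ : 𝔸ˣ := s₄ * g'' * t₃ * g'''⁻¹ * s₃⁻¹ * s₄⁻¹ with hA₃def
    set B₂ : 𝔸ˣ := (s₄ * s₃ * s₂⁻¹) * (g' * t₂ * g'''⁻¹ * s₂⁻¹)⁻¹ * (s₄ * s₃ * s₂⁻¹)⁻¹ with hB₂def
    set C₁ : 𝔸ˣ := (s₄ * s₃ * s₂⁻¹ * s₁⁻¹) * (g * t₁ * g'⁻¹ * s₁⁻¹)⁻¹ * (s₄ * s₃ * s₂⁻¹ * s₁⁻¹)⁻¹ with hC₁def
    have hsplit : ((W₄ * (A₃ * B₂ * C₁) : 𝔸ˣ) : 𝔸) = (W₄ : 𝔸) * ((A₃ : 𝔸) * (B₂ : 𝔸) * (C₁ : 𝔸)) := by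
      simp only [Units.val_mul]
    rw [hsplit]
    have n4 : ‖(W₄ : 𝔸)‖ ≤ 1 := (mem_U1.1 hW₄m).1
    have nA : ‖(A₃ : 𝔸)‖ ≤ 1 := (mem_U1.1 hc₃).1
    have nAB : ‖(A₃ : 𝔸) * (B₂ : 𝔸)‖ ≤ 1 := by
      rw [← Units.val_mul]; exact (mem_U1.1 ((U1 𝔸).mul_mem hc₃ hBm)).1
    have step4 := B8Ineq170.norm_mul_sub_one_le_of_norm_le_one (b := (A₃ : 𝔸) * (B₂ : 𝔸) * (C₁ : 𝔸)) n4
    have stepABC := B8Ineq170.norm_mul_sub_one_le_of_norm_le_one (b := (C₁ : 𝔸)) nAB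
    have stepAB := B8Ineq170.norm_mul_sub_one_le_of_norm_le_one (b := (B₂ : 𝔸)) nA
    linarith
  -- the substitution `uᵢ ↦ sᵢ`
  have hsub : ‖((((g * (t₁ * t₂ * t₃⁻¹ * t₄⁻¹))⁻¹ * (u₁ * u₂ * u₃⁻¹ * u₄⁻¹ * g)) : 𝔸ˣ) : 𝔸)
      - ((((g * (t₁ * t₂ * t₃⁻¹ * t₄⁻¹))⁻¹ * (s₁ * s₂ * s₃⁻¹ * s₄⁻¹ * g)) : 𝔸ˣ) : 𝔸)‖ ≤ ε₁ + ε₂ + ε₃ + ε₄ := by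
    have e1 : ((((g * (t₁ * t₂ * t₃⁻¹ * t₄⁻¹))⁻¹ * (u₁ * u₂ * u₃⁻¹ * u₄⁻¹ * g)) : 𝔸ˣ) : 𝔸)
        = (((g * (t₁ * t₂ * t₃⁻¹ * t₄⁻¹))⁻¹ : 𝔸ˣ) : 𝔸) * ((u₁ * u₂ * u₃⁻¹ * u₄⁻¹ : 𝔸ˣ) : 𝔸) * (g : 𝔸) := by
      simp only [Units.val_mul, mul_assoc]
    have e2 : ((((g * (t₁ * t₂ * t₃⁻¹ * t₄⁻¹))⁻¹ * (s₁ * s₂ * s₃⁻¹ * s₄⁻¹ * g)) : 𝔸ˣ) : 𝔸)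
        = (((g * (t₁ * t₂ * t₃⁻¹ * t₄⁻¹))⁻¹ : 𝔸ˣ) : 𝔸) * ((s₁ * s₂ * s₃⁻¹ * s₄⁻¹ : 𝔸ˣ) : 𝔸) * (g : 𝔸) := by
      simp only [Units.val_mul, mul_assoc]
    rw [e1, e2]
    refine (norm_sandwich_sub_le (mem_U1.1 ((U1 𝔸).inv_mem hpre)).1 (mem_U1.1 hg).1).trans ?_
    simp only [Units.val_mul]
    have h12 := norm_mul_sub_mul_le (a := (u₁ : 𝔸)) (b := (u₂ : 𝔸)) (a' := (s₁ : 𝔸)) (b' := (s₂ : 𝔸))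
      (mem_U1.1 hu₁).1 (mem_U1.1 hs₂).1
    have h3 := GaugeFieldPerturbation.norm_units_inv_sub_inv_le hu₃ hs₃
    have h4 := GaugeFieldPerturbation.norm_units_inv_sub_inv_le hu₄ hs₄
    have h123 := norm_mul_sub_mul_le (a := (u₁ : 𝔸) * (u₂ : 𝔸)) (b := ((u₃⁻¹ : 𝔸ˣ) : 𝔸))
      (a' := (s₁ : 𝔸) * (s₂ : 𝔸)) (b' := ((s₃⁻¹ : 𝔸ˣ) : 𝔸))
      (by rw [← Units.val_mul]; exact (mem_U1.1 ((U1 𝔸).mul_mem hu₁ hu₂)).1) (mem_U1.1 ((U1 𝔸).inv_mem hs₃)).1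
    have h1234 := norm_mul_sub_mul_le (a := (u₁ : 𝔸) * (u₂ : 𝔸) * ((u₃⁻¹ : 𝔸ˣ) : 𝔸)) (b := ((u₄⁻¹ : 𝔸ˣ) : 𝔸))
      (a' := (s₁ : 𝔸) * (s₂ : 𝔸) * ((s₃⁻¹ : 𝔸ˣ) : 𝔸)) (b' := ((s₄⁻¹ : 𝔸ˣ) : 𝔸))
      (by rw [← Units.val_mul, ← Units.val_mul]; exact (mem_U1.1 ((U1 𝔸).mul_mem ((U1 𝔸).mul_mem hu₁ hu₂) ((U1 𝔸).inv_mem hu₃))).1)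
      (mem_U1.1 ((U1 𝔸).inv_mem hs₄)).1
    linarith
  have e : ((((g * (t₁ * t₂ * t₃⁻¹ * t₄⁻¹))⁻¹ * (u₁ * u₂ * u₃⁻¹ * u₄⁻¹ * g)) : 𝔸ˣ) : 𝔸) - 1
      = (((((g * (t₁ * t₂ * t₃⁻¹ * t₄⁻¹))⁻¹ * (u₁ * u₂ * u₃⁻¹ * u₄⁻¹ * g)) : 𝔸ˣ) : 𝔸)
          - ((((g * (t₁ * t₂ * t₃⁻¹ * t₄⁻¹))⁻¹ * (s₁ * s₂ * s₃⁻¹ * s₄⁻¹ * g)) : 𝔸ˣ) : 𝔸))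
        + (((((g * (t₁ * t₂ * t₃⁻¹ * t₄⁻¹))⁻¹ * (s₁ * s₂ * s₃⁻¹ * s₄⁻¹ * g)) : 𝔸ˣ) : 𝔸) - 1) := by abel
  rw [e]
  exact (norm_add_le _ _).trans (by linarith)

end Fourth

end Summit.QuantumFields.BalabanUV.T4Continuum.NE7b.OneStepLoopLetters

end
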